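import Literature.NumberTheory.LFunctions.Zhang2022.KnifeEdgeLenZDegreeConversion
import Literature.NumberTheory.LFunctions.Zhang2022.Section7aStatements

/-!
# Zhang (2022), rung F-S3 (Landau–Siegel programme, §D edge len = E*-len⁺): route `ZDegreeToeplitzBand`, crux K1″ —
# the F2-conversion hypotheses PER DEGREE: `GradedLemma81At c′ e`, `ThetaGradedNegligibleAt c′ e` (the slices of the ∀-degree
# OPEN Props of `KnifeEdgeLenZDegreeConversion`), the `e = 0` slice IS Zhang's Lemma 8.1 (proved ⟺), and the degree-±2 right-edge
# reductions from the slices a K1″ proof actually needs (e = 2 and e = −2 of graded Lemma 8.1, e = 2 of the vanishing) — PROVED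

Y. Zhang, *Discrete mean estimates and the Landau–Siegel zero*, arXiv:2211.02515v1 [Zhang2022LandauSiegel] — an
unrefereed manuscript under adjudication. **WHAT THIS IS NOT: not a claim about Theorems 1–2 of arXiv:2211.02515, about
Landau–Siegel zeros, or about Parity. The programme SEARCHES and TYPES; no claim about Landau–Siegel zeros, Theorems 1–2 of
arXiv:2211.02515 or a repaired Margin232 until a kernel theorem says so.** `GradedLemma81At`, `ThetaGradedNegligibleAt` are bare
`Prop`s (OPEN, asserted by no one) — the per-degree slices of the author's F2 statements, so that ledger items can name exactly the
degrees the degree-2 table uses (`e = ±2`), and so that the `e = 0` slice is literally the tree's `Skeleton.Lemma81` (nothing new there).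

PART 2 (appended 2026-08-27 by ls-knife-typer-1 g6; route item K1 `PsiGradedTables` stmt-Parity-20014, the K1″a hand's first rung):
THE RIGHT-EDGE INTEGRAND PER DEGREE — PROVED from the tree's theorem `Section7aStatements.step7u014_holds` (Zhang p. 13:
`𝔠(s,ψ)A(𝐚₁;s,ψ) = −i(pt₀)^{β₃}Z(s,ψ)⁻¹Σ_m(κ∗a₁)(m)ψ(m)m^{−s}` on `𝔍(1)`) and `GammaFactor.Zfac_ne_zero`: with the grading unit
`Z(s,ψ)^e` inserted the `𝔍(1)`-integrand is `−i(pt₀)^{β₃}·Z(s,ψ)^{e−1}·(Σ_m(κ∗a₁)ψ m^{−s})·A(𝐚₂;1−s,ψ̄)·ω` (`thetaGraded_eq_sum_I1psiGraded`,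
the graded (7.6) over `Ψ₁`), so `Θ^{(e)} = −iΣ_{ψ∈Ψ₁}(pt₀)^{β₃}I₁^{(e)}(ψ)` with `I1psiGraded` = Zhang's `I₁(ψ)` carrying `Z^{e−1}`
in place of `Z^{−1}`; AT `e = 1` THE INTEGRAND IS ROOT-NUMBER-FREE (`I1psiGraded_one`: the F2 note's «e = 1: net power 0 — NO Gauss
sum» as a kernel fact), and at `e = 0` it is Zhang's `I₁(ψ)` (`I1psiGraded_zero`). What is NOT here: the extension `Ψ₁ → Ψ` ((7.3),
needs Prop. 2.1), the term-by-term integration and the family Gauss moment (`familyGaussMoment_holds`, `k = 1 − e`) — the next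
rungs of the K1″ derivation (typer's order-of-magnitude notes for the K1″a hand: HOME/ls-knife-typer-1/DERIVATION-NOTES-K1a.md).

## References
* Y. Zhang, arXiv:2211.02515v1 (2022), §7 Prop. 7.1 p. 13 (7.1), (7.6), p. 14 (7.4); §8 Lemma 8.1 p. 16; (2.11). [cite: Zhang2022LandauSiegel, §7 p.14 (7.4), §8 Lemma 8.1 p.16]
-/

noncomputable section

open Complex Real ComplexConjugate

namespace Literature.NumberTheory.LFunctions.Zhang2022.KnifeEdge

open Repair Skeleton

section Degrees

variable (c' : ℝ)

/-- **Graded Lemma 8.1 AT DEGREE `e` (OPEN slice):** `Σ_{ψ,ρ} 𝔠*Z^e A A ω = Θ^{(e)} + conj Θ^{(−e)}(conj data) + o(𝔓)` for (7.2)-data,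
under (A), eventually. `GradedLemma81 c′ ↔ ∀ e, GradedLemma81At c′ e`; the `e = 0` slice is `Skeleton.Lemma81 c′`.
[cite: Zhang2022LandauSiegel, §8 Lemma 8.1 p.16, (2.11)] -/
def GradedLemma81At (e : ℤ) : Prop :=
  ∀ B : ℝ, ∀ ε : ℝ, 0 < ε → ForAllLarge fun D _ χ => AssumptionA D χ →
    ∀ a₁ a₂ : ℕ → ℂ, Adm72 D B a₁ → Adm72 D B a₂ →
      ‖lhsGraded c' χ e a₁ a₂ -
          (thetaGraded c' χ e a₁ a₂ +
            conj (thetaGraded c' χ (-e) (fun n => conj (a₂ n)) (fun n => conj (a₁ n))))‖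
        ≤ ε * frakP D

/-- **Right-edge vanishing AT DEGREE `e` (OPEN slice; meaningful for `e ≥ 2`):** `Θ^{(e)} = o(𝔓)` for (7.2)-data, under (A),
eventually. `ThetaGradedNegligible c′ ↔ ∀ e ≥ 2, ThetaGradedNegligibleAt c′ e`. [cite: Zhang2022LandauSiegel, §7 p.14 (7.4)] -/
def ThetaGradedNegligibleAt (e : ℤ) : Prop :=
  ∀ B : ℝ, ∀ ε : ℝ, 0 < ε → ForAllLarge fun D _ χ => AssumptionA D χ →
    ∀ a₁ a₂ : ℕ → ℂ, Adm72 D B a₁ → Adm72 D B a₂ → ‖thetaGraded c' χ e a₁ a₂‖ ≤ ε * frakP D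

variable {c'}

/-- The ∀-degree statement is the conjunction of its slices. [cite: Zhang2022LandauSiegel, §8 Lemma 8.1 p.16] -/
theorem gradedLemma81_iff_forall : GradedLemma81 c' ↔ ∀ e : ℤ, GradedLemma81At c' e := Iff.rfl

/-- … and so is the vanishing statement (for `e ≥ 2`). [cite: Zhang2022LandauSiegel, §7 p.14 (7.4)] -/
theorem thetaGradedNegligible_iff_forall : ThetaGradedNegligible c' ↔ ∀ e : ℤ, 2 ≤ e → ThetaGradedNegligibleAt c' e :=
  ⟨fun h e he => h e he, fun h e he => h e he⟩

/-- **The `e = 0` slice IS Lemma 8.1 as typed (proved ⟺):** `GradedLemma81At c′ 0 ↔ Skeleton.Lemma81 c′` (`lhsGraded_zero`,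
`thetaGraded_zero`). [cite: Zhang2022LandauSiegel, §8 Lemma 8.1 p.16] -/
theorem gradedLemma81At_zero_iff : GradedLemma81At c' 0 ↔ Lemma81 c' := by
  unfold GradedLemma81At Lemma81
  simp only [lhsGraded_zero, thetaGraded_zero, neg_zero]

/-- **Degree `+2` reduction from the slices it uses (proved):** `GradedLemma81At c′ 2` and `ThetaGradedNegligibleAt c′ 2` give
`‖lhs₂(𝐚₁,𝐚₂) − conj Θ^{(−2)}(𝐚̄₂,𝐚̄₁)‖ ≤ ε𝔓` eventually under (A). [cite: Zhang2022LandauSiegel, §7 p.14 (7.4), §8 Lemma 8.1 p.16] -/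
theorem lhsGraded_two_approx_at (h81 : GradedLemma81At c' 2) (hneg : ThetaGradedNegligibleAt c' 2) (B ε : ℝ) (hε : 0 < ε) :
    ForAllLarge fun D _ χ => AssumptionA D χ → ∀ a₁ a₂ : ℕ → ℂ, Adm72 D B a₁ → Adm72 D B a₂ →
      ‖lhsGraded c' χ 2 a₁ a₂ - conj (thetaGraded c' χ (-2) (fun n => conj (a₂ n)) (fun n => conj (a₁ n)))‖
        ≤ ε * frakP D := by
  have hε2 : 0 < ε / 2 := by positivity
  refine ((h81 B (ε / 2) hε2).and (hneg B (ε / 2) hε2)).mono fun D _ χ _ _ h hA a₁ a₂ h₁ h₂ => ?_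
  obtain ⟨hL, hN⟩ := h
  have e1 := hL hA a₁ a₂ h₁ h₂
  have e2 := hN hA a₁ a₂ h₁ h₂
  calc ‖lhsGraded c' χ 2 a₁ a₂ - conj (thetaGraded c' χ (-2) (fun n => conj (a₂ n)) (fun n => conj (a₁ n)))‖
      = ‖(lhsGraded c' χ 2 a₁ a₂ - (thetaGraded c' χ 2 a₁ a₂ +
            conj (thetaGraded c' χ (-2) (fun n => conj (a₂ n)) (fun n => conj (a₁ n))))) + thetaGraded c' χ 2 a₁ a₂‖ := by
          ring_nf
    _ ≤ ‖lhsGraded c' χ 2 a₁ a₂ - (thetaGraded c' χ 2 a₁ a₂ +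
            conj (thetaGraded c' χ (-2) (fun n => conj (a₂ n)) (fun n => conj (a₁ n))))‖ + ‖thetaGraded c' χ 2 a₁ a₂‖ :=
          norm_add_le _ _
    _ ≤ ε / 2 * frakP D + ε / 2 * frakP D := add_le_add e1 e2
    _ = ε * frakP D := by ring

/-- **Degree `−2` reduction from the slices it uses (proved):** `GradedLemma81At c′ (−2)` and `ThetaGradedNegligibleAt c′ 2` give
`‖lhs₋₂(𝐚₁,𝐚₂) − Θ^{(−2)}(𝐚₁,𝐚₂)‖ ≤ ε𝔓` eventually under (A) ((7.2) is conjugation-invariant, tree `Section8aStatements.adm72_conj`,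
restated inline). [cite: Zhang2022LandauSiegel, §7 p.14 (7.4), §8 Lemma 8.1 p.16, §7 (7.2)] -/
theorem lhsGraded_neg_two_approx_at (h81 : GradedLemma81At c' (-2)) (hneg : ThetaGradedNegligibleAt c' 2) (B ε : ℝ)
    (hε : 0 < ε) :
    ForAllLarge fun D _ χ => AssumptionA D χ → ∀ a₁ a₂ : ℕ → ℂ, Adm72 D B a₁ → Adm72 D B a₂ →
      ‖lhsGraded c' χ (-2) a₁ a₂ - thetaGraded c' χ (-2) a₁ a₂‖ ≤ ε * frakP D := by
  have hε2 : 0 < ε / 2 := by positivity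
  refine ((h81 B (ε / 2) hε2).and (hneg B (ε / 2) hε2)).mono fun D _ χ _ _ h hA a₁ a₂ h₁ h₂ => ?_
  obtain ⟨hL, hN⟩ := h
  have e1 := hL hA a₁ a₂ h₁ h₂
  have hc : ∀ {a : ℕ → ℂ}, Adm72 D B a → Adm72 D B (fun n => conj (a n)) := fun h =>
    ⟨fun n => by rw [Complex.norm_conj]; exact h.1 n, fun n hn => by show conj (_ : ℂ) = 0; rw [h.2 n hn, map_zero]⟩
  have e2 := hN hA (fun n => conj (a₂ n)) (fun n => conj (a₁ n)) (hc h₂) (hc h₁)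
  rw [neg_neg] at e1
  have e2' : ‖conj (thetaGraded c' χ 2 (fun n => conj (a₂ n)) (fun n => conj (a₁ n)))‖ ≤ ε / 2 * frakP D := by
    rw [Complex.norm_conj]; exact e2
  calc ‖lhsGraded c' χ (-2) a₁ a₂ - thetaGraded c' χ (-2) a₁ a₂‖
      = ‖(lhsGraded c' χ (-2) a₁ a₂ - (thetaGraded c' χ (-2) a₁ a₂ +
            conj (thetaGraded c' χ 2 (fun n => conj (a₂ n)) (fun n => conj (a₁ n))))) +
            conj (thetaGraded c' χ 2 (fun n => conj (a₂ n)) (fun n => conj (a₁ n)))‖ := by ring_nf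
    _ ≤ ‖lhsGraded c' χ (-2) a₁ a₂ - (thetaGraded c' χ (-2) a₁ a₂ +
            conj (thetaGraded c' χ 2 (fun n => conj (a₂ n)) (fun n => conj (a₁ n))))‖ +
          ‖conj (thetaGraded c' χ 2 (fun n => conj (a₂ n)) (fun n => conj (a₁ n)))‖ := norm_add_le _ _
    _ ≤ ε / 2 * frakP D + ε / 2 * frakP D := add_le_add e1 e2'
    _ = ε * frakP D := by ring

end Degrees

/-! ### Part 2 — the RIGHT-EDGE INTEGRAND PER DEGREE (graded (7.6) over `Ψ₁`; PROVED from `step7u014_holds`) -/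

section RightEdge

variable (c' : ℝ) {D : ℕ}

/-- **Graded `I₁(ψ)`:** `I₁^{(e)}(ψ) = (1/2πi)∫_{𝔍(1)} Z(s,ψ)^{e−1}·(Σ_m(κ∗a₁)(m)ψ(m)m^{−s})·A(𝐚₂;1−s,ψ̄)·ω(s)ds` — Zhang's `I₁(ψ)`
of (7.6) (tree `Section7bStatements.I1psi`, `e = 0`) with the grading unit's net power `Z^{e−1}` (F2 note §2).
[cite: Zhang2022LandauSiegel, §7 (7.6) p.13] -/
def I1psiGraded (x : Chr D) (e : ℤ) (a₁ a₂ : ℕ → ℂ) : ℂ :=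
  Lemma81.segInt (t0 D) (ell1 D) 1 fun s =>
    GammaFactor.Zfac x.ψ s ^ (e - 1) * Section7aStatements.kconvSeries c' x a₁ s * ApolyBar x a₂ (1 - s) * omegaW D s

omit c' in
/-- Points of `𝔍(1)` in the tree's parametrisation `s = 1 + s₀ + iv`, `|v| ≤ 𝓛₁`, lie in `segJ D 1` and have positive
imaginary part once `𝓛₁ < 2πt₀` (true for `𝓛 ≥ 1`). [cite: Zhang2022LandauSiegel, §2 (2.8), §7 p.13] -/
theorem segPoint_one_mem_and_im_pos (hℓ : 1 ≤ ell D) {v : ℝ} (hv : v ∈ Set.uIcc (-ell1 D) (ell1 D)) :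
    ((1 : ℂ) + SmoothWeight.s0 (t0 D) + v * I) ∈ Section7aStatements.segJ D 1 ∧
      0 < ((1 : ℂ) + SmoothWeight.s0 (t0 D) + v * I).im := by
  have hℓ0 : 0 ≤ ell1 D := by rw [ell1]; positivity
  rw [Set.uIcc_of_le (by linarith), Set.mem_Icc] at hv
  have habs : |v| ≤ ell1 D := abs_le.mpr ⟨hv.1, hv.2⟩
  have him : ((1 : ℂ) + SmoothWeight.s0 (t0 D) + v * I).im = 2 * π * t0 D + v := by
    simp [SmoothWeight.s0]
  refine ⟨⟨by simp [SmoothWeight.s0]; ring, by rw [him]; simpa using habs⟩, ?_⟩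
  rw [him]
  -- `𝓛₁ = 𝓛⁴⁰⁵ ≤ 𝓛⁵¹⁹ = t₀ < 2πt₀`
  have h1 : ell1 D ≤ t0 D := by
    rw [ell1, t0]; exact pow_le_pow_right₀ hℓ (by norm_num)
  have h2 : 0 < t0 D := by rw [t0]; positivity
  have h3 : t0 D < 2 * π * t0 D := by
    have : (1 : ℝ) < 2 * π := by linarith [Real.pi_gt_three]
    nlinarith
  linarith [hv.1]

/-- **The graded (7.6) over `Ψ₁` (proved):** for `𝐚₁` satisfying (7.2),
`Θ^{(e)}(𝐚₁,𝐚₂) = Σ_{ψ∈Ψ₁} (−i(pt₀)^{β₃})·I₁^{(e)}(ψ)` — the right-edge integrand of the graded mean is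
`−i(pt₀)^{β₃}·Z(s,ψ)^{e−1}·Σ_m(κ∗a₁)ψm^{−s}·A(𝐚₂;1−s,ψ̄)·ω` (tree `step7u014_holds` + `Z ≠ 0` on `𝔍(1)`).
[cite: Zhang2022LandauSiegel, §7 (7.1), (7.6) p.13] -/
theorem thetaGraded_eq_sum_I1psiGraded [NeZero D] (χ : DirichletCharacter ℂ D) (hℓ : 1 ≤ ell D) (e : ℤ) {B : ℝ}
    {a₁ : ℕ → ℂ} (ha₁ : Adm72 D B a₁) (a₂ : ℕ → ℂ) :
    thetaGraded c' χ e a₁ a₂ =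
      ∑ x ∈ finsetOf (PsiOne χ), -I * (((x.p : ℝ) * t0 D : ℝ) : ℂ) ^ beta3 c' D * I1psiGraded c' x e a₁ a₂ := by
  unfold thetaGraded
  refine Finset.sum_congr rfl fun x _ => ?_
  have hpt : ∀ v ∈ Set.uIcc (-ell1 D) (ell1 D),
      frakcW c' x ((1 : ℂ) + SmoothWeight.s0 (t0 D) + v * I) *
            GammaFactor.Zfac x.ψ ((1 : ℂ) + SmoothWeight.s0 (t0 D) + v * I) ^ e *
            Apoly x a₁ ((1 : ℂ) + SmoothWeight.s0 (t0 D) + v * I) *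
            ApolyBar x a₂ (1 - ((1 : ℂ) + SmoothWeight.s0 (t0 D) + v * I)) *
          omegaW D ((1 : ℂ) + SmoothWeight.s0 (t0 D) + v * I) =
        -I * (((x.p : ℝ) * t0 D : ℝ) : ℂ) ^ beta3 c' D *
          (GammaFactor.Zfac x.ψ ((1 : ℂ) + SmoothWeight.s0 (t0 D) + v * I) ^ (e - 1) *
              Section7aStatements.kconvSeries c' x a₁ ((1 : ℂ) + SmoothWeight.s0 (t0 D) + v * I) *
              ApolyBar x a₂ (1 - ((1 : ℂ) + SmoothWeight.s0 (t0 D) + v * I)) *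
            omegaW D ((1 : ℂ) + SmoothWeight.s0 (t0 D) + v * I)) := by
    intro v hv
    obtain ⟨hseg, him⟩ := segPoint_one_mem_and_im_pos hℓ hv
    set s : ℂ := (1 : ℂ) + SmoothWeight.s0 (t0 D) + v * I with hs
    have h14 := Section7aStatements.step7u014_holds c' D x B a₁ ha₁ s hseg
    have hZ : GammaFactor.Zfac x.ψ s ≠ 0 := GammaFactor.Zfac_ne_zero x.prim him
    calc frakcW c' x s * GammaFactor.Zfac x.ψ s ^ e * Apoly x a₁ s * ApolyBar x a₂ (1 - s) * omegaW D s
        = (frakcW c' x s * Apoly x a₁ s) * GammaFactor.Zfac x.ψ s ^ e * ApolyBar x a₂ (1 - s) * omegaW D s := by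
          ring
      _ = -I * (((x.p : ℝ) * t0 D : ℝ) : ℂ) ^ beta3 c' D *
            ((GammaFactor.Zfac x.ψ s)⁻¹ * GammaFactor.Zfac x.ψ s ^ e *
              Section7aStatements.kconvSeries c' x a₁ s * ApolyBar x a₂ (1 - s) * omegaW D s) := by
          rw [h14]; ring
      _ = _ := by rw [← zpow_neg_one, ← zpow_add₀ hZ, show (-1 : ℤ) + e = e - 1 by ring]
  rw [I1psiGraded, Lemma81.segInt, Lemma81.segInt, intervalIntegral.integral_congr hpt,
    intervalIntegral.integral_const_mul]
  ring

/-- **At `e = 1` the right-edge integrand carries NO root number** (F2 note §2 «e = 1: net power 0 — no Gauss sum»; the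
family sum then meets plain ψ-orthogonality): `I₁^{(1)}(ψ) = (1/2πi)∫_{𝔍(1)} (Σ_m(κ∗a₁)ψm^{−s})·A(𝐚₂;1−s,ψ̄)·ω ds`.
[cite: Zhang2022LandauSiegel, §7 (7.6) p.13] -/
theorem I1psiGraded_one (x : Chr D) (a₁ a₂ : ℕ → ℂ) :
    I1psiGraded c' x 1 a₁ a₂ = Lemma81.segInt (t0 D) (ell1 D) 1 fun s =>
      Section7aStatements.kconvSeries c' x a₁ s * ApolyBar x a₂ (1 - s) * omegaW D s := by
  unfold I1psiGraded
  simp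

/-- **At `e = 0` it is Zhang's `I₁(ψ)`** (the `Z(s,ψ)⁻¹` of (7.6); tree `Section7bStatements.I1psi` spells the `m`-series with
`kappaConv`, the same function as `Section7aStatements.kconv` — `Section7bStatements.kappaConv_eq_conv`). [cite: Zhang2022LandauSiegel, §7 (7.6) p.13] -/
theorem I1psiGraded_zero (x : Chr D) (a₁ a₂ : ℕ → ℂ) :
    I1psiGraded c' x 0 a₁ a₂ = Lemma81.segInt (t0 D) (ell1 D) 1 fun s =>
      (GammaFactor.Zfac x.ψ s)⁻¹ * Section7aStatements.kconvSeries c' x a₁ s * ApolyBar x a₂ (1 - s) * omegaW D s := by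
  unfold I1psiGraded
  simp

/-- **At `e ≤ 0` the integrand carries `Z(s,ψ)^{−(1−e)}`**, i.e. `1 − e ≥ 1` inverse root numbers — the Gauss content
`τ(ψ̄)^{1−e}` whose family average is the `Kl_{1−e}` moment (`KnifeEdgeLenZDegree.familyGaussMoment_holds`).
[cite: Zhang2022LandauSiegel, §7 (7.6) p.13, (2.5)] -/
theorem I1psiGraded_of_le (x : Chr D) (e : ℤ) (a₁ a₂ : ℕ → ℂ) :
    I1psiGraded c' x e a₁ a₂ = Lemma81.segInt (t0 D) (ell1 D) 1 fun s =>
      ((GammaFactor.Zfac x.ψ s)⁻¹) ^ (1 - e) * Section7aStatements.kconvSeries c' x a₁ s * ApolyBar x a₂ (1 - s) *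
        omegaW D s := by
  unfold I1psiGraded
  congr 1
  funext s
  rw [inv_zpow', show -(1 - e) = e - 1 by ring]

end RightEdge

end Literature.NumberTheory.LFunctions.Zhang2022.KnifeEdge

end
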